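import Summits.Ventures.Crystal3D.Theorems.StickyWulffConstantCoaxialWallLawSeamSatCensusTwelve
import Literature.Algebra.EuclideanLattices.FccBccLattices
import HarnessLib

/-!
# The D₅ₕ «two-ring» dozen: an explicit twelve-ball kissing configuration with exactly TWO pairs in `(2, 5/2)` that is neither FCC nor HCP —
# the two-exempt-pairs relaxation of `KissingClassificationOneFree (5/2)` is FALSE
# (crux `CoaxialWallLaw`, stmt-Ventures-19481; lane F 'Certificates' v8.4/8.5, stubs `stub_satCensus12Narrow` / `stub_satCensus12Glide` ⇐ C1 =
#  `KissingClassificationOneFree (5/2)` of '…SeamSatCensusTwelve'; companion of '…SeamSatCensusTwelveOneFreeDegree')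

HONEST FRAMING. Venture `Summits/Ventures/Crystal3D` (cell `crystal3d-full`); helper `--supports` stmt-Ventures-19481; NEGATIVE KNOWLEDGE for certificate
design, nothing registered is refuted.  C1 (every twelve-point configuration of `S²(2)` with all pairs `= 2` or `≥ 5/2` EXCEPT ONE is FCC/HCP) is the
uncertified input of `satCensus12_of_oneFree`.  This file shows that C1 is TIGHT in the number of exemptions: with TWO exempt pairs the classification fails.
THE WITNESS (all squared distances rational): poles `(0, 0, ±2)` and two ALIGNED five-rings at heights `±1`, radius `√3`, azimuths `kγ`, `γ = arccos (1/3)`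
(the tetrahedral dihedral angle), written in the encoding `twoRingEnc z = ((z₁/81)√3, (z₂/81)√6, z₃/81)` with integer triples `z` (`cos kγ ∈ {1, 1/3, −7/9, −23/27, 17/81}`,
`sin kγ ∈ √2·{0, 2/3, 4/9, −10/27, −56/81}`): `twoRingQ` = the twelve triples, `twoRing` = their image.
* `twoRing_card` (= 12), norms `2`, pairwise `≥ 2` (`twoRingQ_checks`, one `decide` on the integer Gram form `twoRingForm`);
* **`twoRing_dichotomy_twoFree`** — every pair is `= 2` or `≥ 5/2` apart except the two ring-closing pairs (squared distance `128/27`, chord `≈ 2.177`);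
* **`not_isArrangedIn_twoRing_fcc / _hcp`** — it is neither FCC nor HCP (those have all distances `2` or `≥ 2h₀ = 2.52`, `isKissingConfig_fcc/_hcp`;
  `128/27 < 2.52²`);
* **`exists_twoFree_not_arranged`** — packaged: a twelve-point configuration on `S²(2)`, pairwise `≥ 2`, all pairs bimodal at `5/2` but two, not FCC/HCP;
* `twoRing_pole_five_contacts` — the north pole has FIVE contacts (the bound of '…OneFreeDegree' `card_contacts_le_five_of_oneFree` is attained once two
  pairs are exempt; there the five-contact node forces the exempt pair among its contacts — here each pole sees one exempt pair).
For `SatCensus12` this configuration is harmless (two DISJOINT free pairs ⇒ four unsaturated neighbours by GAP ⇒ deficiency ≥ 4); its role is to show that a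
certificate for C1 must use «exactly one exempt pair» (memo ADVZ-C1-g21 §B3).
WHAT THIS IS NOT: not a statement about C1 itself (which stays open and numerically robust); no registered stub touched; F-C1 not moved.
-/

noncomputable section

namespace Summit.Ventures.Crystal3D.Theorems

namespace TailResidue

open Summit.Ventures.Crystal3D Finset
open Literature.Geometry.DiscreteGeometry (fccKissingPattern hcpKissingPattern IsArrangedIn IsKissingConfig isKissingConfig_fcc isKissingConfig_hcp hales_h0 hales_h0_eq)
open Literature.Algebra.EuclideanLattices (inner_fin_three)
open scoped InnerProductSpace

/-! ### The encoding `((z₁/81)√3, (z₂/81)√6, z₃/81)` -/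

/-- The vector `((z₁/81)·√3, (z₂/81)·√6, z₃/81)` for an integer triple `z`. -/
def twoRingEnc (z : ℤ × ℤ × ℤ) : EuclideanSpace ℝ (Fin 3) :=
  !₂[(z.1 : ℝ) / 81 * Real.sqrt 3, (z.2.1 : ℝ) / 81 * Real.sqrt 6, (z.2.2 : ℝ) / 81]

/-- The INTEGER bilinear form computing inner products of encoded vectors: `⟪twoRingEnc z, twoRingEnc w⟫ = twoRingForm z w / 6561`. -/
def twoRingForm (z w : ℤ × ℤ × ℤ) : ℤ := 3 * (z.1 * w.1) + 6 * (z.2.1 * w.2.1) + z.2.2 * w.2.2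

/-- First coordinate. -/
@[simp] theorem twoRingEnc_apply_zero (z : ℤ × ℤ × ℤ) : twoRingEnc z 0 = (z.1 : ℝ) / 81 * Real.sqrt 3 := by simp [twoRingEnc]
/-- Second coordinate. -/
@[simp] theorem twoRingEnc_apply_one (z : ℤ × ℤ × ℤ) : twoRingEnc z 1 = (z.2.1 : ℝ) / 81 * Real.sqrt 6 := by simp [twoRingEnc]
/-- Third coordinate. -/
@[simp] theorem twoRingEnc_apply_two (z : ℤ × ℤ × ℤ) : twoRingEnc z 2 = (z.2.2 : ℝ) / 81 := by simp [twoRingEnc]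

/-- **Inner products of encoded vectors are rational**: `⟪twoRingEnc z, twoRingEnc w⟫ = twoRingForm z w / 6561`. -/
theorem inner_twoRingEnc (z w : ℤ × ℤ × ℤ) : ⟪twoRingEnc z, twoRingEnc w⟫_ℝ = ((twoRingForm z w : ℤ) : ℝ) / 6561 := by
  have h3 : Real.sqrt 3 * Real.sqrt 3 = 3 := Real.mul_self_sqrt (by norm_num)
  have h6 : Real.sqrt 6 * Real.sqrt 6 = 6 := Real.mul_self_sqrt (by norm_num)
  rw [inner_fin_three, twoRingEnc_apply_zero, twoRingEnc_apply_zero, twoRingEnc_apply_one, twoRingEnc_apply_one, twoRingEnc_apply_two,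
    twoRingEnc_apply_two, twoRingForm]
  push_cast
  have e1 : ((z.1 : ℝ) / 81 * Real.sqrt 3) * ((w.1 : ℝ) / 81 * Real.sqrt 3) = 3 * ((z.1 : ℝ) * w.1) / 6561 := by
    rw [mul_mul_mul_comm, h3]; ring
  have e2 : ((z.2.1 : ℝ) / 81 * Real.sqrt 6) * ((w.2.1 : ℝ) / 81 * Real.sqrt 6) = 6 * ((z.2.1 : ℝ) * w.2.1) / 6561 := by
    rw [mul_mul_mul_comm, h6]; ring
  rw [e1, e2]; ring

/-- Squared distances of encoded vectors: `dist² = twoRingForm (z − w) (z − w) / 6561`, written with the form expanded. -/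
theorem dist_sq_twoRingEnc (z w : ℤ × ℤ × ℤ) :
    dist (twoRingEnc z) (twoRingEnc w) ^ 2 = ((twoRingForm z z - 2 * twoRingForm z w + twoRingForm w w : ℤ) : ℝ) / 6561 := by
  rw [dist_eq_norm, ← real_inner_self_eq_norm_sq, inner_sub_left, inner_sub_right, inner_sub_right, inner_twoRingEnc, inner_twoRingEnc,
    inner_twoRingEnc, inner_twoRingEnc]
  have hs : twoRingForm w z = twoRingForm z w := by unfold twoRingForm; ring
  rw [hs]; push_cast; ring

/-- `twoRingEnc` is injective. -/
theorem twoRingEnc_injective : Function.Injective twoRingEnc := by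
  intro r s h
  have h0 := congrArg (fun x : EuclideanSpace ℝ (Fin 3) => x 0) h
  have h1 := congrArg (fun x : EuclideanSpace ℝ (Fin 3) => x 1) h
  have h2 := congrArg (fun x : EuclideanSpace ℝ (Fin 3) => x 2) h
  simp only [twoRingEnc_apply_zero, twoRingEnc_apply_one, twoRingEnc_apply_two] at h0 h1 h2
  have hs3 : (0 : ℝ) < Real.sqrt 3 := Real.sqrt_pos.2 (by norm_num)
  have hs6 : (0 : ℝ) < Real.sqrt 6 := Real.sqrt_pos.2 (by norm_num)
  have h0' : (r.1 : ℝ) / 81 = (s.1 : ℝ) / 81 := mul_right_cancel₀ hs3.ne' h0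
  have h1' : (r.2.1 : ℝ) / 81 = (s.2.1 : ℝ) / 81 := mul_right_cancel₀ hs6.ne' h1
  have e0 : (r.1 : ℝ) = s.1 := by linarith
  have e1 : (r.2.1 : ℝ) = s.2.1 := by linarith
  have e2 : (r.2.2 : ℝ) = s.2.2 := by linarith
  refine Prod.ext (by exact_mod_cast e0) (Prod.ext (by exact_mod_cast e1) (by exact_mod_cast e2))

/-! ### The witness -/

/-- The twelve integer triples (`×81`): north pole, south pole, upper ring (height `81` = `1`), lower ring (height `−81`), azimuths `kγ`, `cos γ = 1/3`. -/
def twoRingQ : Finset (ℤ × ℤ × ℤ) :=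
  {(0, 0, 162), (0, 0, -162),
   (81, 0, 81), (27, 54, 81), (-63, 36, 81), (-69, -30, 81), (17, -56, 81),
   (81, 0, -81), (27, 54, -81), (-63, 36, -81), (-69, -30, -81), (17, -56, -81)}

/-- The two ring-closing pairs, as ORDERED pairs of integer triples (both orders): `{(81,0,81), (17,−56,81)}` (upper ring) and `{(81,0,−81), (17,−56,−81)}` (lower). -/
def twoRingExemptPairs : Finset ((ℤ × ℤ × ℤ) × (ℤ × ℤ × ℤ)) :=
  {((81, 0, 81), (17, -56, 81)), ((17, -56, 81), (81, 0, 81)), ((81, 0, -81), (17, -56, -81)), ((17, -56, -81), (81, 0, -81))}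

/-- **The two-ring configuration** `⊂ S²(2)`. -/
def twoRing : Finset (EuclideanSpace ℝ (Fin 3)) := twoRingQ.image twoRingEnc

/-- Twelve points. -/
theorem twoRing_card : twoRing.card = 12 := by
  rw [twoRing, card_image_of_injective _ twoRingEnc_injective]; decide

/-- The integer checks (one `decide`): norms (`form = 4·6561`), packing (`dist² ≥ 4`), and the dichotomy `dist² = 4 ∨ 4·dist² ≥ 25` off the two exempt pairs,
whose squared distance is `128/27` (`form = 31104`). -/
theorem twoRingQ_checks :
    (∀ r ∈ twoRingQ, twoRingForm r r = 26244) ∧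
    (∀ r ∈ twoRingQ, ∀ s ∈ twoRingQ, r ≠ s → 26244 ≤ twoRingForm r r - 2 * twoRingForm r s + twoRingForm s s) ∧
    (∀ r ∈ twoRingQ, ∀ s ∈ twoRingQ, r ≠ s → (r, s) ∉ twoRingExemptPairs →
      twoRingForm r r - 2 * twoRingForm r s + twoRingForm s s = 26244 ∨ 164025 ≤ 4 * (twoRingForm r r - 2 * twoRingForm r s + twoRingForm s s)) ∧
    (∀ r ∈ twoRingQ, ∀ s ∈ twoRingQ, (r, s) ∈ twoRingExemptPairs → twoRingForm r r - 2 * twoRingForm r s + twoRingForm s s = 31104) := by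
  refine ⟨by decide, by decide, by decide, by decide⟩

/-- Every point of `twoRing` has norm `2`. -/
theorem norm_eq_two_of_mem_twoRing {x : EuclideanSpace ℝ (Fin 3)} (hx : x ∈ twoRing) : ‖x‖ = 2 := by
  obtain ⟨r, hr, rfl⟩ := Finset.mem_image.1 hx
  have h1 : ‖twoRingEnc r‖ ^ 2 = 4 := by
    rw [← real_inner_self_eq_norm_sq, inner_twoRingEnc, twoRingQ_checks.1 r hr]; norm_num
  nlinarith [norm_nonneg (twoRingEnc r)]

/-- Distinct points of `twoRing` are `≥ 2` apart. -/
theorem two_le_dist_of_mem_twoRing {x y : EuclideanSpace ℝ (Fin 3)} (hx : x ∈ twoRing) (hy : y ∈ twoRing) (hxy : x ≠ y) : 2 ≤ dist x y := by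
  obtain ⟨r, hr, rfl⟩ := Finset.mem_image.1 hx
  obtain ⟨s, hs, rfl⟩ := Finset.mem_image.1 hy
  have hrs : r ≠ s := fun h => hxy (by rw [h])
  have h := twoRingQ_checks.2.1 r hr s hs hrs
  have hd : (4 : ℝ) ≤ dist (twoRingEnc r) (twoRingEnc s) ^ 2 := by
    rw [dist_sq_twoRingEnc]
    have : ((26244 : ℤ) : ℝ) ≤ ((twoRingForm r r - 2 * twoRingForm r s + twoRingForm s s : ℤ) : ℝ) := by exact_mod_cast h
    push_cast at this ⊢; linarith
  nlinarith [dist_nonneg (x := twoRingEnc r) (y := twoRingEnc s)]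

/-- **Dichotomy with two exemptions.**  Every pair of `twoRing` is at distance `2` or `≥ 5/2` EXCEPT the two ring-closing pairs. -/
theorem twoRing_dichotomy_twoFree {x y : EuclideanSpace ℝ (Fin 3)} (hx : x ∈ twoRing) (hy : y ∈ twoRing) :
    x = y ∨ dist x y = 2 ∨ (5 / 2 : ℝ) ≤ dist x y ∨
      (x = twoRingEnc (81, 0, 81) ∧ y = twoRingEnc (17, -56, 81)) ∨ (x = twoRingEnc (17, -56, 81) ∧ y = twoRingEnc (81, 0, 81)) ∨
      (x = twoRingEnc (81, 0, -81) ∧ y = twoRingEnc (17, -56, -81)) ∨ (x = twoRingEnc (17, -56, -81) ∧ y = twoRingEnc (81, 0, -81)) := by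
  obtain ⟨r, hr, rfl⟩ := Finset.mem_image.1 hx
  obtain ⟨s, hs, rfl⟩ := Finset.mem_image.1 hy
  by_cases hrs : r = s
  · exact Or.inl (by rw [hrs])
  by_cases hex : (r, s) ∈ twoRingExemptPairs
  · have hex' : (r = (81, 0, 81) ∧ s = (17, -56, 81)) ∨ (r = (17, -56, 81) ∧ s = (81, 0, 81)) ∨
        (r = (81, 0, -81) ∧ s = (17, -56, -81)) ∨ (r = (17, -56, -81) ∧ s = (81, 0, -81)) := by
      simpa [twoRingExemptPairs, Prod.ext_iff] using hex
    rcases hex' with ⟨rfl, rfl⟩ | ⟨rfl, rfl⟩ | ⟨rfl, rfl⟩ | ⟨rfl, rfl⟩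
    · exact Or.inr (Or.inr (Or.inr (Or.inl ⟨rfl, rfl⟩)))
    · exact Or.inr (Or.inr (Or.inr (Or.inr (Or.inl ⟨rfl, rfl⟩))))
    · exact Or.inr (Or.inr (Or.inr (Or.inr (Or.inr (Or.inl ⟨rfl, rfl⟩)))))
    · exact Or.inr (Or.inr (Or.inr (Or.inr (Or.inr (Or.inr ⟨rfl, rfl⟩)))))
  have hd0 : 0 ≤ dist (twoRingEnc r) (twoRingEnc s) := dist_nonneg
  rcases twoRingQ_checks.2.2.1 r hr s hs hrs hex with h | h
  · refine Or.inr (Or.inl ?_)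
    have hd : dist (twoRingEnc r) (twoRingEnc s) ^ 2 = 4 := by
      rw [dist_sq_twoRingEnc]
      have : ((twoRingForm r r - 2 * twoRingForm r s + twoRingForm s s : ℤ) : ℝ) = 26244 := by exact_mod_cast h
      rw [this]; norm_num
    nlinarith
  · refine Or.inr (Or.inr (Or.inl ?_))
    have hd : (25 / 4 : ℝ) ≤ dist (twoRingEnc r) (twoRingEnc s) ^ 2 := by
      rw [dist_sq_twoRingEnc]
      have : ((164025 : ℤ) : ℝ) ≤ ((4 * (twoRingForm r r - 2 * twoRingForm r s + twoRingForm s s) : ℤ) : ℝ) := by exact_mod_cast h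
      push_cast at this ⊢; linarith
    nlinarith

/-- The exempt pairs ARE in the open window: squared distance `128/27 ∈ (4, 25/4)` (and `< (2h₀)² = 6.3504`). -/
theorem dist_sq_exempt : dist (twoRingEnc (81, 0, 81)) (twoRingEnc (17, -56, 81)) ^ 2 = 128 / 27 ∧
    dist (twoRingEnc (81, 0, -81)) (twoRingEnc (17, -56, -81)) ^ 2 = 128 / 27 := by
  constructor <;> (rw [dist_sq_twoRingEnc]; norm_num [twoRingForm])

/-! ### Not FCC, not HCP -/

/-- A set arranged in a pattern whose doubled copy lies in Hales's class `𝒱` has all its pairs at distance `2` or `≥ 2h₀`: linear isometries preserve distances. -/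
theorem dichotomy_of_isArrangedIn {T : Set (EuclideanSpace ℝ (Fin 3))} {P : Finset (EuclideanSpace ℝ (Fin 3))} (h : IsArrangedIn T P)
    (hP : IsKissingConfig ((fun p => (2 : ℝ) • p) '' (P : Set (EuclideanSpace ℝ (Fin 3)))))
    {x y : EuclideanSpace ℝ (Fin 3)} (hx : x ∈ T) (hy : y ∈ T) : x = y ∨ dist x y = 2 ∨ 2 * hales_h0 ≤ dist x y := by
  obtain ⟨A, rfl⟩ := h
  obtain ⟨p, hp, rfl⟩ := hx
  obtain ⟨q, hq, rfl⟩ := hy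
  have hp' : (2 : ℝ) • p ∈ (fun p => (2 : ℝ) • p) '' (P : Set (EuclideanSpace ℝ (Fin 3))) := ⟨p, hp, rfl⟩
  have hq' : (2 : ℝ) • q ∈ (fun p => (2 : ℝ) • p) '' (P : Set (EuclideanSpace ℝ (Fin 3))) := ⟨q, hq, rfl⟩
  have hd : dist ((2 : ℝ) • A p) ((2 : ℝ) • A q) = dist ((2 : ℝ) • p) ((2 : ℝ) • q) := by
    rw [dist_eq_norm, dist_eq_norm, ← smul_sub, ← smul_sub, ← map_sub, norm_smul, norm_smul, LinearIsometry.norm_map]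
  rcases hP.2.2 _ hp' _ hq' with e | e | e
  · left
    have : dist ((2 : ℝ) • A p) ((2 : ℝ) • A q) = 0 := by rw [hd, e, dist_self]
    exact dist_eq_zero.1 this
  · exact Or.inr (Or.inl (hd.trans e))
  · exact Or.inr (Or.inr (hd ▸ e))

/-- `(2h₀)² = 6.3504 > 128/27`: the exempt pair violates Hales's dichotomy. -/
theorem not_dichotomy_exempt : ¬ (twoRingEnc (81, 0, 81) = twoRingEnc (17, -56, 81) ∨ dist (twoRingEnc (81, 0, 81)) (twoRingEnc (17, -56, 81)) = 2 ∨
    2 * hales_h0 ≤ dist (twoRingEnc (81, 0, 81)) (twoRingEnc (17, -56, 81))) := by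
  have hsq := dist_sq_exempt.1
  rintro (h | h | h)
  · exact absurd (twoRingEnc_injective h) (by decide)
  · rw [h] at hsq; norm_num at hsq
  · rw [hales_h0_eq] at h
    have h0 : (0 : ℝ) ≤ 2 * 1.26 := by norm_num
    nlinarith [mul_le_mul h h h0 (h0.trans h)]

/-- The two members of the first exempt pair lie in `twoRing`. -/
theorem exempt_mem : twoRingEnc (81, 0, 81) ∈ twoRing ∧ twoRingEnc (17, -56, 81) ∈ twoRing :=
  ⟨Finset.mem_image_of_mem _ (by decide), Finset.mem_image_of_mem _ (by decide)⟩

/-- **The two-ring dozen is NOT arranged in the FCC pattern.** -/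
theorem not_isArrangedIn_twoRing_fcc : ¬ IsArrangedIn (twoRing : Set (EuclideanSpace ℝ (Fin 3))) fccKissingPattern := fun h =>
  not_dichotomy_exempt (dichotomy_of_isArrangedIn h isKissingConfig_fcc (Finset.mem_coe.2 exempt_mem.1) (Finset.mem_coe.2 exempt_mem.2))

/-- **The two-ring dozen is NOT arranged in the HCP pattern.** -/
theorem not_isArrangedIn_twoRing_hcp : ¬ IsArrangedIn (twoRing : Set (EuclideanSpace ℝ (Fin 3))) hcpKissingPattern := fun h =>
  not_dichotomy_exempt (dichotomy_of_isArrangedIn h isKissingConfig_hcp (Finset.mem_coe.2 exempt_mem.1) (Finset.mem_coe.2 exempt_mem.2))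

/-! ### Packaging -/

/-- **The two-exempt-pairs relaxation of `KissingClassificationOneFree (5/2)` is FALSE**: there is a twelve-point configuration on `S²(2)`, pairwise `≥ 2` apart, every
pair at distance `2` or `≥ 5/2` except (at most) two pairs `{a, b}`, `{c, d}`, which is arranged neither in the FCC nor in the HCP pattern.  (Witness: `twoRing`.) -/
theorem exists_twoFree_not_arranged :
    ∃ S : Set (EuclideanSpace ℝ (Fin 3)), S.ncard = 12 ∧ (∀ x ∈ S, ‖x‖ = 2) ∧ (∀ x ∈ S, ∀ y ∈ S, x = y ∨ 2 ≤ dist x y) ∧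
      (∃ a b c d : EuclideanSpace ℝ (Fin 3), ∀ x ∈ S, ∀ y ∈ S,
        x = y ∨ dist x y = 2 ∨ (5 / 2 : ℝ) ≤ dist x y ∨ (x = a ∧ y = b) ∨ (x = b ∧ y = a) ∨ (x = c ∧ y = d) ∨ (x = d ∧ y = c)) ∧
      ¬ IsArrangedIn S fccKissingPattern ∧ ¬ IsArrangedIn S hcpKissingPattern := by
  refine ⟨(twoRing : Set (EuclideanSpace ℝ (Fin 3))), ?_, fun x hx => norm_eq_two_of_mem_twoRing (Finset.mem_coe.1 hx), fun x hx y hy => ?_,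
    ⟨twoRingEnc (81, 0, 81), twoRingEnc (17, -56, 81), twoRingEnc (81, 0, -81), twoRingEnc (17, -56, -81), fun x hx y hy =>
      twoRing_dichotomy_twoFree (Finset.mem_coe.1 hx) (Finset.mem_coe.1 hy)⟩,
    not_isArrangedIn_twoRing_fcc, not_isArrangedIn_twoRing_hcp⟩
  · rw [Set.ncard_coe_finset, twoRing_card]
  · by_cases hxy : x = y
    · exact Or.inl hxy
    · exact Or.inr (two_le_dist_of_mem_twoRing (Finset.mem_coe.1 hx) (Finset.mem_coe.1 hy) hxy)

/-- Integer table: the members of `twoRingQ` at squared distance `4` from the north pole are exactly the five upper-ring triples. -/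
theorem twoRingQ_pole_contacts : ∀ r ∈ twoRingQ, twoRingForm r r - 2 * twoRingForm r (0, 0, 162) + twoRingForm (0, 0, 162) (0, 0, 162) = 26244 →
    r ∈ ({(81, 0, 81), (27, 54, 81), (-63, 36, 81), (-69, -30, 81), (17, -56, 81)} : Finset (ℤ × ℤ × ℤ)) := by
  decide

/-- **The north pole has FIVE contacts** (the whole upper ring): the node-degree bound `5` of '…OneFreeDegree' is attained as soon as two pairs are exempt. -/
theorem twoRing_pole_five_contacts :
    (twoRing.filter fun u => dist u (twoRingEnc (0, 0, 162)) = 2).card = 5 := by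
  classical
  have key : twoRing.filter (fun u => dist u (twoRingEnc (0, 0, 162)) = 2) =
      ({(81, 0, 81), (27, 54, 81), (-63, 36, 81), (-69, -30, 81), (17, -56, 81)} : Finset (ℤ × ℤ × ℤ)).image twoRingEnc := by
    ext u
    simp only [twoRing, mem_filter, mem_image]
    constructor
    · rintro ⟨⟨r, hr, rfl⟩, hd⟩
      refine ⟨r, ?_, rfl⟩
      have hsq : dist (twoRingEnc r) (twoRingEnc (0, 0, 162)) ^ 2 = 4 := by rw [hd]; norm_num
      rw [dist_sq_twoRingEnc] at hsq
      have hint : twoRingForm r r - 2 * twoRingForm r (0, 0, 162) + twoRingForm (0, 0, 162) (0, 0, 162) = 26244 := by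
        have : ((twoRingForm r r - 2 * twoRingForm r (0, 0, 162) + twoRingForm (0, 0, 162) (0, 0, 162) : ℤ) : ℝ) = 26244 := by linarith
        exact_mod_cast this
      exact twoRingQ_pole_contacts r hr hint
    · rintro ⟨r, hr, rfl⟩
      refine ⟨⟨r, ?_, rfl⟩, ?_⟩
      · revert r; decide
      · have hsq : dist (twoRingEnc r) (twoRingEnc (0, 0, 162)) ^ 2 = 4 := by
          rw [dist_sq_twoRingEnc]
          have hint : twoRingForm r r - 2 * twoRingForm r (0, 0, 162) + twoRingForm (0, 0, 162) (0, 0, 162) = 26244 := by revert r; decide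
          have : ((twoRingForm r r - 2 * twoRingForm r (0, 0, 162) + twoRingForm (0, 0, 162) (0, 0, 162) : ℤ) : ℝ) = 26244 := by exact_mod_cast hint
          rw [this]; norm_num
        nlinarith [dist_nonneg (x := twoRingEnc r) (y := twoRingEnc (0, 0, 162))]
  rw [key, card_image_of_injective _ twoRingEnc_injective]; decide

end TailResidue

end Summit.Ventures.Crystal3D.Theorems

end
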